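import Summits.Schanuel.Schanuel.Theorems.SoloInformedAEAnalyticCore

/-!
# Integrality of 3-term-AP defects of served roots (Lemma AE₃, algebraic and analytic core)

Solo-informed Schanuel seat, session s182 (2026-08-31); companion of
`SoloInformedSquaredDifferenceIntegrality` / `SoloInformedAEAnalyticCore` (Lemma AE).  Those two
files price INEXACT ADDITIVE COINCIDENCES `ρ₁ − ρ₂ ≈ ρ₃ − ρ₄` among the roots of `F ∈ ℤ[T]`
through the equation of squared differences, at the cost `2 D (D-1)² · log M(F)` (per-variable
degree of the symmetric polynomial `≍ D³`).  This file prices the cheaper pattern of INEXACT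
3-TERM ARITHMETIC PROGRESSIONS `ρ_i + ρ_k ≈ 2 ρ_j`: the linear forms
`L_t = ρ_i + ρ_k − 2 ρ_j`, `t = (i, j, k) ∈ (Fin D)³`, form a family stable under permutations
of the roots, and each variable occurs in only `3 D² − 3 D + 1 ≤ 3 D²` of them, so the
symmetric-function device costs only `3 D² · log M(F)`:

* `soloAP_pow_mul_prod_eq_intCast` — **algebraic core** (any domain `K` of characteristic
  zero): `a ^ (3 D²) · ∏_{t : L_t ≠ 0} L_t ∈ ℤ` (`a` the leading coefficient, roots enumerated
  with multiplicity, product over ALL triples `t ∈ (Fin D)³` with `L_t ≠ 0`).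
* `soloAP_one_le_abs_pow_mul_prod_norm` — over `ℂ`, `F ≠ 0`: `1 ≤ |a| ^ (3 D²) · ∏ ‖L_t‖`.
* `soloAP_one_le_pow_mul_mahlerMeasure_pow` / `soloAP_card_mul_log_le` — **analytic core**:
  for any finset `T` of triples with `L_t ≠ 0` and `‖L_t‖ ≤ ε`,
  `1 ≤ ε ^ #T · 4 ^ (D³) · M(F) ^ (3 D²)`, i.e.
  `#T · log (1/ε) ≤ 3 D² · log M(F) + D³ · log 4`
  (from `‖L_t‖ ≤ 4 · max(1,‖ρ_i‖) max(1,‖ρ_j‖) max(1,‖ρ_k‖)` and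
  `M(F) = |a| ∏ max(1,‖ρ_l‖)`; the powers of `|a|` cancel exactly).
* Pieces (prefix `soloAP_`): `rename_lin`, `degreeOf_lin_le`, `sum_indicator_fst/snd/thd`,
  `sum_degreeOf_lin_le` (the budget `3 D²`), `isSymmetric_lin_esymm`, `norm_lin_le`,
  `prod_triples_eq`.  The generic pieces (value lemma, substituted elementary symmetric
  polynomials, `a ^ m · P(roots) ∈ ℤ`, Mahler measure via a root enumeration) are imported from
  the two companion files.

## Why (seat bookkeeping; pen side `paper/AE-note.md` §14, session s182)

Lemma AE prices inexact additive QUADRUPLES (`≍ K³` of them among `K` served roots) at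
`2 D (D-1)² · log M` per family of ordered ones; Lemma AE₃ prices inexact 3-term PROGRESSIONS
(`≍ K²/2` ordered ones) at `3 D² · log M` per family (dictionary: `SoloInformedLemmaAE3`).
Information/price is `≍ K³/D³` versus `≍ K²/D²`,
and a served set has `K ≤ 1.02 D`, so the progression pattern is never worse and is strictly
better whenever `K/D → 0`: in the seat's Theorem AE-1 the budget inequality
`K⁴ n^ν ≫ n⁴ n^β` (`ν > 4 + β − 4σ`, file `SoloInformedTheoremAE1`) becomes `K³ n^ν ≫ n³ n^β`
(`ν > 3 + β − 3σ`) once the additive-rigidity step is run on progressions (robust 3-AP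
rigidity; separate files).  Numerical sanity check of the integrality statement (random
`F`, `D ≤ 5`, including root sets with exact progressions): kit job `j343230` (all cases
integral to `400` digits).  Nothing in this file bears on the summit statement
`Literature.Periods.SchanuelConjecture`; it is bookkeeping for the seat's toy node
`RoyAdditiveDirichletExponent` ([cite: Roy2010, Thm 1.1]); the seat's verdict (no path) is
unchanged.  Classical device, no novelty claimed: [cite: Baker1975, Ch. 8 §3, p. 84]
[corpus: book:baker1975-transcendental-number-theory p.84].  Mathlib + the seat files only;
no definitions; no literature hypotheses; axioms the standard three.
-/

namespace Summit.Schanuel.Schanuel.Theorems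

open MvPolynomial Finset

section LinearForms

variable {D : ℕ}

/-- `rename σ` permutes the linear forms `X_i + X_k − 2 X_j`. -/
theorem soloAP_rename_lin (σ : Equiv.Perm (Fin D)) (t : Fin D × Fin D × Fin D) :
    rename σ (X t.1 + X t.2.2 - 2 * X t.2.1 : MvPolynomial (Fin D) ℤ)
      = X (σ t.1) + X (σ t.2.2) - 2 * X (σ t.2.1) := by
  simp only [map_sub, map_add, map_mul, rename_X, map_ofNat]

/-- Degree count for one linear form: `degreeOf i (X_a + X_c − 2 X_b) ≤ [i=a] + [i=c] + [i=b]`.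
-/
theorem soloAP_degreeOf_lin_le (i : Fin D) (t : Fin D × Fin D × Fin D) :
    degreeOf i (X t.1 + X t.2.2 - 2 * X t.2.1 : MvPolynomial (Fin D) ℤ)
      ≤ (if i = t.1 then 1 else 0) + (if i = t.2.2 then 1 else 0)
        + (if i = t.2.1 then 1 else 0) := by
  classical
  have hX : ∀ j : Fin D, degreeOf i (X j : MvPolynomial (Fin D) ℤ) ≤ if i = j then 1 else 0 := by
    intro j
    split_ifs with h
    · subst h; simp
    · rw [degreeOf_X_of_ne h]
  have h2 : degreeOf i (2 : MvPolynomial (Fin D) ℤ) = 0 := by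
    rw [← map_ofNat (C : ℤ →+* MvPolynomial (Fin D) ℤ) 2]; exact degreeOf_C _ _
  have hmul : degreeOf i (2 * X t.2.1 : MvPolynomial (Fin D) ℤ) ≤ if i = t.2.1 then 1 else 0 := by
    refine (degreeOf_mul_le _ _ _).trans ?_
    rw [h2, zero_add]; exact hX _
  refine (degreeOf_sub_le _ _ _).trans (max_le ?_ (hmul.trans (Nat.le_add_left _ _)))
  refine (degreeOf_add_le _ _ _).trans (max_le ?_ ?_)
  · exact (hX t.1).trans ((Nat.le_add_right _ _).trans (Nat.le_add_right _ _))
  · exact (hX t.2.2).trans ((Nat.le_add_left _ _).trans (Nat.le_add_right _ _))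

/-- `∑_{t ∈ (Fin D)³} [i = t.1] = D²`. -/
theorem soloAP_sum_indicator_fst (i : Fin D) :
    ∑ t : Fin D × Fin D × Fin D, (if i = t.1 then 1 else 0 : ℕ) = D * D := by
  classical
  rw [Finset.sum_boole]
  have : (univ.filter (fun t : Fin D × Fin D × Fin D => i = t.1)) =
      ({i} : Finset (Fin D)) ×ˢ (univ : Finset (Fin D × Fin D)) := by
    ext ⟨a, b, c⟩
    simp only [Finset.mem_filter, Finset.mem_univ, true_and, Finset.mem_product,
      Finset.mem_singleton, and_true]
    exact eq_comm
  rw [Nat.cast_id, this, Finset.card_product, Finset.card_singleton, Finset.card_univ,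
    Fintype.card_prod, Fintype.card_fin, one_mul]

/-- `∑_{t ∈ (Fin D)³} [i = t.2.1] = D²`. -/
theorem soloAP_sum_indicator_snd (i : Fin D) :
    ∑ t : Fin D × Fin D × Fin D, (if i = t.2.1 then 1 else 0 : ℕ) = D * D := by
  classical
  rw [Finset.sum_boole]
  have : (univ.filter (fun t : Fin D × Fin D × Fin D => i = t.2.1)) =
      (univ : Finset (Fin D)) ×ˢ (({i} : Finset (Fin D)) ×ˢ (univ : Finset (Fin D))) := by
    ext ⟨a, b, c⟩
    simp only [Finset.mem_filter, Finset.mem_univ, true_and, Finset.mem_product,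
      Finset.mem_singleton, and_true]
    exact eq_comm
  rw [Nat.cast_id, this, Finset.card_product, Finset.card_product, Finset.card_singleton,
    Finset.card_univ, Fintype.card_fin, one_mul]

/-- `∑_{t ∈ (Fin D)³} [i = t.2.2] = D²`. -/
theorem soloAP_sum_indicator_thd (i : Fin D) :
    ∑ t : Fin D × Fin D × Fin D, (if i = t.2.2 then 1 else 0 : ℕ) = D * D := by
  classical
  rw [Finset.sum_boole]
  have : (univ.filter (fun t : Fin D × Fin D × Fin D => i = t.2.2)) =
      (univ : Finset (Fin D)) ×ˢ ((univ : Finset (Fin D)) ×ˢ ({i} : Finset (Fin D))) := by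
    ext ⟨a, b, c⟩
    simp only [Finset.mem_filter, Finset.mem_univ, true_and, Finset.mem_product,
      Finset.mem_singleton]
    exact eq_comm
  rw [Nat.cast_id, this, Finset.card_product, Finset.card_product, Finset.card_singleton,
    Finset.card_univ, Fintype.card_fin, mul_one]

/-- Degree budget: summed over all triples, the `Xᵢ`-degrees of the linear forms total at most
`3 D²` (exactly `3 D² − 3 D + 1` of the forms involve `Xᵢ`; the cruder count suffices). -/
theorem soloAP_sum_degreeOf_lin_le (i : Fin D) :
    ∑ t : Fin D × Fin D × Fin D,
        degreeOf i (X t.1 + X t.2.2 - 2 * X t.2.1 : MvPolynomial (Fin D) ℤ)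
      ≤ 3 * D ^ 2 := by
  classical
  calc ∑ t : Fin D × Fin D × Fin D,
        degreeOf i (X t.1 + X t.2.2 - 2 * X t.2.1 : MvPolynomial (Fin D) ℤ)
      ≤ ∑ t : Fin D × Fin D × Fin D, ((if i = t.1 then 1 else 0) + (if i = t.2.2 then 1 else 0)
          + (if i = t.2.1 then 1 else 0)) :=
        Finset.sum_le_sum fun t _ => soloAP_degreeOf_lin_le i t
    _ = 3 * D ^ 2 := by
        rw [Finset.sum_add_distrib, Finset.sum_add_distrib, soloAP_sum_indicator_fst,
          soloAP_sum_indicator_thd, soloAP_sum_indicator_snd]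
        ring

/-- The substituted elementary symmetric polynomials of the linear forms are symmetric in
`X₀, …, X_{D-1}`: a permutation of the variables permutes the triples. -/
theorem soloAP_isSymmetric_lin_esymm (k : ℕ) :
    (aeval (fun t : Fin D × Fin D × Fin D =>
        (X t.1 + X t.2.2 - 2 * X t.2.1 : MvPolynomial (Fin D) ℤ))
      (esymm (Fin D × Fin D × Fin D) ℤ k)).IsSymmetric := by
  intro σ
  refine soloSD_rename_aeval_esymm_eq σ _ (Equiv.prodCongr σ (Equiv.prodCongr σ σ))
    (fun t => ?_) k
  rw [soloAP_rename_lin]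
  rfl

/-- `‖x + z − 2 y‖ ≤ 4 · max(1,‖x‖) · max(1,‖y‖) · max(1,‖z‖)`. -/
theorem soloAP_norm_lin_le (x y z : ℂ) :
    ‖x + z - 2 * y‖ ≤ 4 * max 1 ‖x‖ * max 1 ‖y‖ * max 1 ‖z‖ := by
  have hx : ‖x‖ ≤ max 1 ‖x‖ := le_max_right _ _
  have hy : ‖y‖ ≤ max 1 ‖y‖ := le_max_right _ _
  have hz : ‖z‖ ≤ max 1 ‖z‖ := le_max_right _ _
  have h1x : 1 ≤ max 1 ‖x‖ := le_max_left _ _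
  have h1y : 1 ≤ max 1 ‖y‖ := le_max_left _ _
  have h1z : 1 ≤ max 1 ‖z‖ := le_max_left _ _
  have htri : ‖x + z - 2 * y‖ ≤ ‖x‖ + ‖z‖ + 2 * ‖y‖ := by
    calc ‖x + z - 2 * y‖ ≤ ‖x + z‖ + ‖2 * y‖ := norm_sub_le _ _
      _ ≤ ‖x‖ + ‖z‖ + 2 * ‖y‖ := by
          rw [norm_mul, Complex.norm_two]
          linarith [norm_add_le x z]
  have hab : 1 ≤ max 1 ‖x‖ * max 1 ‖y‖ := one_le_mul_of_one_le_of_one_le h1x h1y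
  have hbc : 1 ≤ max 1 ‖y‖ * max 1 ‖z‖ := one_le_mul_of_one_le_of_one_le h1y h1z
  have hA : max 1 ‖x‖ ≤ max 1 ‖x‖ * max 1 ‖y‖ * max 1 ‖z‖ := by
    rw [mul_assoc]; exact le_mul_of_one_le_right (zero_le_one.trans h1x) hbc
  have hC : max 1 ‖z‖ ≤ max 1 ‖x‖ * max 1 ‖y‖ * max 1 ‖z‖ :=
    le_mul_of_one_le_left (zero_le_one.trans h1z) hab
  have hB : max 1 ‖y‖ ≤ max 1 ‖x‖ * max 1 ‖y‖ * max 1 ‖z‖ :=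
    calc max 1 ‖y‖ ≤ max 1 ‖x‖ * max 1 ‖y‖ :=
          le_mul_of_one_le_left (zero_le_one.trans h1y) h1x
      _ ≤ max 1 ‖x‖ * max 1 ‖y‖ * max 1 ‖z‖ :=
          le_mul_of_one_le_right (zero_le_one.trans hab) h1z
  linarith

/-- Triple-product bookkeeping: `∏_t 4 g(t.1) g(t.2.1) g(t.2.2) = 4^{D³} (∏ g)^{3 D²}`. -/
theorem soloAP_prod_triples_eq (g : Fin D → ℝ) :
    ∏ t : Fin D × Fin D × Fin D, (4 * g t.1 * g t.2.1 * g t.2.2)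
      = 4 ^ (D ^ 3) * (∏ l, g l) ^ (3 * D ^ 2) := by
  simp only [Finset.prod_mul_distrib, Fintype.prod_prod_type, Finset.prod_const,
    Finset.card_univ, Fintype.card_fin, Finset.prod_pow, Fintype.card_prod]
  ring

end LinearForms

section Main

variable {D : ℕ}

/-- **Integrality of 3-AP defects (algebraic core).**  Over any domain `K` of characteristic
zero: let `F : ℤ[X]` have `natDegree F = D` and leading coefficient `a`, let `ρ : Fin D → K`
enumerate the roots of `F` in `K` with multiplicity, and put `L t = ρ t.1 + ρ t.2.2 − 2 ρ t.2.1`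
for `t ∈ (Fin D)³`.  Then `a ^ (3 D²) · ∏_{t : L t ≠ 0} L t` is a rational integer. -/
theorem soloAP_pow_mul_prod_eq_intCast {K : Type*} [CommRing K] [IsDomain K] [CharZero K]
    [DecidableEq K] (F : Polynomial ℤ) (hD : F.natDegree = D) (ρ : Fin D → K)
    (hρ : univ.val.map ρ = (F.map (Int.castRingHom K)).roots)
    (L : Fin D × Fin D × Fin D → K) (hL : ∀ t, L t = ρ t.1 + ρ t.2.2 - 2 * ρ t.2.1) :
    ∃ N : ℤ, (F.leadingCoeff : K) ^ (3 * D ^ 2) *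
      ∏ t ∈ (univ : Finset (Fin D × Fin D × Fin D)) with L t ≠ 0, L t = N := by
  -- the substituted family (kept opaque) and its values
  obtain ⟨x, hx⟩ : ∃ x : Fin D × Fin D × Fin D → MvPolynomial (Fin D) ℤ,
      x = fun t => X t.1 + X t.2.2 - 2 * X t.2.1 := ⟨_, rfl⟩
  have hy : ∀ t, aeval ρ (x t) = L t := by
    intro t
    simp only [hx, hL, map_sub, map_add, map_mul, aeval_X, map_ofNat]
  obtain ⟨J, hJ⟩ : ∃ J : Finset (Fin D × Fin D × Fin D), J = univ.filter (fun t => L t ≠ 0) :=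
    ⟨_, rfl⟩
  -- the symmetric integer polynomial whose value at `ρ` is the product over `J`
  obtain ⟨P, hP⟩ : ∃ P : MvPolynomial (Fin D) ℤ,
      P = aeval x (esymm (Fin D × Fin D × Fin D) ℤ #J) := ⟨_, rfl⟩
  have hPsymm : P.IsSymmetric := by
    rw [hP, hx]; exact soloAP_isSymmetric_lin_esymm (D := D) #J
  have hm : ∀ i, P.degreeOf i ≤ 3 * D ^ 2 := by
    intro i
    rw [hP]
    refine (soloSD_degreeOf_aeval_esymm_le x i _).trans ?_
    rw [hx]
    exact soloAP_sum_degreeOf_lin_le i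
  have hval : aeval ρ P = ∏ t ∈ J, L t := by
    rw [hP, soloSD_aeval_aeval_esymm]
    simp_rw [hy]
    rw [hJ]
    exact soloSD_sum_powersetCard_prod_eq_prod_filter _ _
  obtain ⟨N, hN⟩ := soloSI_leadingCoeff_pow_mul_aeval_roots_eq_intCast F hD ρ hρ P hPsymm hm
  refine ⟨N, ?_⟩
  rw [← hJ, ← hval]
  exact hN

/-- Over `ℂ`, with `F ≠ 0`: `1 ≤ |a| ^ (3 D²) · ∏_{t : L t ≠ 0} ‖L t‖`. -/
theorem soloAP_one_le_abs_pow_mul_prod_norm (F : Polynomial ℤ) (hF : F ≠ 0)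
    (hD : F.natDegree = D) (ρ : Fin D → ℂ)
    (hρ : univ.val.map ρ = (F.map (Int.castRingHom ℂ)).roots)
    (L : Fin D × Fin D × Fin D → ℂ) (hL : ∀ t, L t = ρ t.1 + ρ t.2.2 - 2 * ρ t.2.1) :
    1 ≤ |(F.leadingCoeff : ℝ)| ^ (3 * D ^ 2) *
      ∏ t ∈ (univ : Finset (Fin D × Fin D × Fin D)) with L t ≠ 0, ‖L t‖ := by
  obtain ⟨N, hN⟩ := soloAP_pow_mul_prod_eq_intCast F hD ρ hρ L hL
  have ha : (F.leadingCoeff : ℂ) ≠ 0 := by exact_mod_cast Polynomial.leadingCoeff_ne_zero.mpr hF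
  have hN0 : N ≠ 0 := by
    rintro rfl
    rw [Int.cast_zero, mul_eq_zero] at hN
    rcases hN with h | h
    · exact pow_ne_zero _ ha h
    · exact (Finset.prod_ne_zero_iff.mpr (fun t ht => (Finset.mem_filter.mp ht).2)) h
  have hnorm := congrArg norm hN
  rw [norm_mul, norm_pow, Complex.norm_intCast, norm_prod, Complex.norm_intCast] at hnorm
  rw [hnorm]
  exact_mod_cast Int.one_le_abs hN0

/-- **AE₃ analytic core (multiplicative form).**  For any finset `T` of triples with
`L t ≠ 0` and `‖L t‖ ≤ ε`: `1 ≤ ε ^ #T · 4 ^ (D³) · M(F) ^ (3 D²)`. -/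
theorem soloAP_one_le_pow_mul_mahlerMeasure_pow (F : Polynomial ℤ) (hF : F ≠ 0)
    (hD : F.natDegree = D) (ρ : Fin D → ℂ)
    (hρ : univ.val.map ρ = (F.map (Int.castRingHom ℂ)).roots)
    (L : Fin D × Fin D × Fin D → ℂ) (hL : ∀ t, L t = ρ t.1 + ρ t.2.2 - 2 * ρ t.2.1)
    {ε : ℝ} (hε : 0 ≤ ε) (T : Finset (Fin D × Fin D × Fin D))
    (hT : ∀ t ∈ T, L t ≠ 0 ∧ ‖L t‖ ≤ ε) :
    1 ≤ ε ^ #T * 4 ^ (D ^ 3) * (F.map (Int.castRingHom ℂ)).mahlerMeasure ^ (3 * D ^ 2) := by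
  classical
  obtain ⟨g, hg⟩ : ∃ g : Fin D → ℝ, ∀ l, g l = max 1 ‖ρ l‖ := ⟨_, fun _ => rfl⟩
  obtain ⟨J, hJ⟩ : ∃ J : Finset (Fin D × Fin D × Fin D), J = univ.filter (fun t => L t ≠ 0) :=
    ⟨_, rfl⟩
  have h1g : ∀ l, 1 ≤ g l := fun l => by rw [hg]; exact le_max_left _ _
  have h0g : ∀ l, 0 ≤ g l := fun l => zero_le_one.trans (h1g l)
  have hB1 : ∀ t : Fin D × Fin D × Fin D, 1 ≤ 4 * g t.1 * g t.2.1 * g t.2.2 := by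
    intro t
    have h := one_le_mul_of_one_le_of_one_le
      (one_le_mul_of_one_le_of_one_le (h1g t.1) (h1g t.2.1)) (h1g t.2.2)
    linarith
  have hTJ : T ⊆ J := fun t ht => by
    rw [hJ]; exact Finset.mem_filter.mpr ⟨Finset.mem_univ _, (hT t ht).1⟩
  -- the integrality lower bound
  have hAE1 := soloAP_one_le_abs_pow_mul_prod_norm F hF hD ρ hρ L hL
  rw [← hJ] at hAE1
  -- the trivial upper bound for the product over `J`
  have hLle : ∀ t, ‖L t‖ ≤ 4 * g t.1 * g t.2.1 * g t.2.2 := by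
    intro t
    rw [hL, hg, hg, hg]
    exact soloAP_norm_lin_le (ρ t.1) (ρ t.2.1) (ρ t.2.2)
  have hstep : ∏ t ∈ J, ‖L t‖ ≤
      ε ^ #T * ∏ t : Fin D × Fin D × Fin D, (4 * g t.1 * g t.2.1 * g t.2.2) := by
    calc ∏ t ∈ J, ‖L t‖
        ≤ ∏ t ∈ J, (if t ∈ T then ε else 4 * g t.1 * g t.2.1 * g t.2.2) := by
          refine Finset.prod_le_prod (fun t _ => norm_nonneg _) (fun t _ => ?_)
          split_ifs with h
          · exact (hT t h).2
          · exact hLle t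
      _ = (∏ t ∈ T, (if t ∈ T then ε else 4 * g t.1 * g t.2.1 * g t.2.2)) *
            ∏ t ∈ J \ T, (if t ∈ T then ε else 4 * g t.1 * g t.2.1 * g t.2.2) := by
          rw [← Finset.prod_sdiff hTJ, mul_comm]
      _ = ε ^ #T * ∏ t ∈ J \ T, (4 * g t.1 * g t.2.1 * g t.2.2) := by
          congr 1
          · rw [Finset.prod_congr rfl (fun t ht => if_pos ht), Finset.prod_const]
          · exact Finset.prod_congr rfl (fun t ht => if_neg (Finset.mem_sdiff.mp ht).2)
      _ ≤ ε ^ #T * ∏ t : Fin D × Fin D × Fin D, (4 * g t.1 * g t.2.1 * g t.2.2) :=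
          mul_le_mul_of_nonneg_left (Finset.prod_le_prod_of_subset_of_one_le
            (Finset.subset_univ _) (fun t _ => zero_le_one.trans (hB1 t))
            (fun t _ _ => hB1 t)) (pow_nonneg hε _)
  have htriples := soloAP_prod_triples_eq (D := D) g
  have hM : (F.map (Int.castRingHom ℂ)).mahlerMeasure = |(F.leadingCoeff : ℝ)| * ∏ l, g l := by
    rw [soloAE_mahlerMeasure_map_eq F ρ hρ]
    simp only [hg]
  rw [hM]
  calc (1 : ℝ) ≤ |(F.leadingCoeff : ℝ)| ^ (3 * D ^ 2) * ∏ t ∈ J, ‖L t‖ := hAE1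
    _ ≤ |(F.leadingCoeff : ℝ)| ^ (3 * D ^ 2) *
        (ε ^ #T * (4 ^ (D ^ 3) * (∏ l, g l) ^ (3 * D ^ 2))) := by
        refine mul_le_mul_of_nonneg_left ?_ (pow_nonneg (abs_nonneg _) _)
        rw [← htriples]
        exact hstep
    _ = ε ^ #T * 4 ^ (D ^ 3) * (|(F.leadingCoeff : ℝ)| * ∏ l, g l) ^ (3 * D ^ 2) := by ring

/-- **AE₃ analytic core (logarithmic form).**  `#T · log(1/ε) ≤ 3 D² · log M(F) + D³ · log 4`.
-/
theorem soloAP_card_mul_log_le (F : Polynomial ℤ) (hF : F ≠ 0)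
    (hD : F.natDegree = D) (ρ : Fin D → ℂ)
    (hρ : univ.val.map ρ = (F.map (Int.castRingHom ℂ)).roots)
    (L : Fin D × Fin D × Fin D → ℂ) (hL : ∀ t, L t = ρ t.1 + ρ t.2.2 - 2 * ρ t.2.1)
    {ε : ℝ} (hε : 0 < ε) (T : Finset (Fin D × Fin D × Fin D))
    (hT : ∀ t ∈ T, L t ≠ 0 ∧ ‖L t‖ ≤ ε) :
    (#T : ℝ) * Real.log (1 / ε) ≤
      ((3 * D ^ 2 : ℕ) : ℝ) * Real.log (F.map (Int.castRingHom ℂ)).mahlerMeasure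
        + ((D ^ 3 : ℕ) : ℝ) * Real.log 4 := by
  have h := soloAP_one_le_pow_mul_mahlerMeasure_pow F hF hD ρ hρ L hL hε.le T hT
  have hF' : F.map (Int.castRingHom ℂ) ≠ 0 :=
    (Polynomial.map_ne_zero_iff (Int.castRingHom ℂ).injective_int).mpr hF
  have hMpos : 0 < (F.map (Int.castRingHom ℂ)).mahlerMeasure :=
    Polynomial.mahlerMeasure_pos_of_ne_zero hF'
  have hlog := Real.log_le_log one_pos h
  rw [Real.log_one, Real.log_mul (by positivity) (by positivity),
    Real.log_mul (by positivity) (by positivity), Real.log_pow, Real.log_pow,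
    Real.log_pow] at hlog
  rw [one_div, Real.log_inv]
  linarith

end Main

end Summit.Schanuel.Schanuel.Theorems
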